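import Summits.BirchSwinnertonDyer.Rank1Residual.X2.DualRestrictionInvariants
import Literature.NumberTheory.EllipticCurves.IwasawaSelmerIsTorsionProofs
import HarnessLib

/-!
# Route `SignedLowerHalves`, crux L `SmallImageLowerHalfBothSigns` (stmt-BirchSwinnertonDyer-23599), line `rtt_w3` v13 — E2, row (6′c), LEAD:
# THE INDEX OF (SURJECTION ∘ INJECTION): `λ(coker (j∘s)) + λ(ker j) = λ(coker s) + λ(ker (j∘s))`

WHY (BRIEF-E2 rev 3.2 §2 step 2, `Lines/rtt_w3-BRIEF-E2-g9c.md`). The junction map of row (6′) is `eH = j ∘ sp¹` with `sp¹ : Hsp ↪ 𝐇¹_Σ(K^cyc_∞, T*)` INJECTIVE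
(`coker sp¹ ≅ H²₂[f]`) and `j = π ∘ loc_v : 𝐇¹_Σ ↠ ker gX` SURJECTIVE (Poitou–Tate; `ker j = 𝐒`, the compact Selmer group). The index identity p777767
(`lambdaInvariant_quotient_span_add_ker_eq`) reduces the glue's `hK` to `χ(eH) := λ(coker eH) − λ(ker eH)`; this file computes it:
`λ(coker (j∘s)) + λ(ker j) = λ(coker s) + λ(ker (j∘s))`, i.e. `χ(j ∘ s) = λ(coker s) − λ(ker j) = λ(H²₂[f]) − λ(𝐒)` (`lambdaInvariant_coker_comp_add_ker_eq`).
Proof: `j` induces `B/s(A) ↠ H/js(A)` with kernel the image `K̄` of `K = ker j`; `K ↠ K̄` has kernel `K ⊓ s(A) ≅ ker (j∘s)`; additivity of `λ`.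
THEOREMS ONLY (kernel commutative algebra). [cite: Washington1997, §13.2] [folklore]
-/

set_option linter.dupNamespace false -- D-0017: single-problem summit, the namespace repeats the problem name by design
set_option autoImplicit false

noncomputable section

namespace Summit.BirchSwinnertonDyer.BirchSwinnertonDyer.Theorems.SmallImageRttCharRoad

open Literature.NumberTheory.EllipticCurves

universe u v w

variable {p : ℕ} [Fact p.Prime] {A : Type u} {B : Type v} {H : Type w} [AddCommGroup A] [Module (IwasawaAlgebra p) A]
  [AddCommGroup B] [Module (IwasawaAlgebra p) B] [AddCommGroup H] [Module (IwasawaAlgebra p) H]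

/-- **Index of a surjection after an injection.** `s : A → B` injective with `B ⧸ s(A)` finitely generated torsion, `j : B → H` surjective with `ker j`
finitely generated torsion: `λ(H ⧸ range (j∘s)) + λ(ker j) = λ(B ⧸ range s) + λ(ker (j∘s))`. In E2 (row (6′c)): `s = sp¹`, `j = π ∘ loc_v`,
`λ(B ⧸ range s) = λ(H²₂[f])`, `λ(ker j) = λ(𝐒)`. [cite: Washington1997, §13.2] [folklore] -/
theorem lambdaInvariant_coker_comp_add_ker_eq (s : A →ₗ[IwasawaAlgebra p] B) (hs : Function.Injective s) (j : B →ₗ[IwasawaAlgebra p] H)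
    (hj : Function.Surjective j) [Module.Finite (IwasawaAlgebra p) (B ⧸ LinearMap.range s)]
    (ht₁ : Module.IsTorsion (IwasawaAlgebra p) (B ⧸ LinearMap.range s)) [Module.Finite (IwasawaAlgebra p) (LinearMap.ker j)]
    (ht₂ : Module.IsTorsion (IwasawaAlgebra p) (LinearMap.ker j)) :
    lambdaInvariant p (H ⧸ LinearMap.range (j ∘ₗ s)) + lambdaInvariant p (LinearMap.ker j) =
      lambdaInvariant p (B ⧸ LinearMap.range s) + lambdaInvariant p (LinearMap.ker (j ∘ₗ s)) := by
  set R := LinearMap.range s with hR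
  set K := LinearMap.ker j with hK
  set g := j ∘ₗ s with hg
  -- `π₁ : B/R ↠ H/range g` induced by `j`
  have hRle : R ≤ (LinearMap.range g).comap j := by
    rintro _ ⟨a, rfl⟩
    exact ⟨a, rfl⟩
  let π₁ : (B ⧸ R) →ₗ[IwasawaAlgebra p] (H ⧸ LinearMap.range g) := R.mapQ (LinearMap.range g) j hRle
  have hπ₁ : Function.Surjective π₁ := by
    intro y
    induction y using Submodule.Quotient.induction_on with
    | H x =>
      obtain ⟨b, rfl⟩ := hj x
      exact ⟨Submodule.Quotient.mk b, rfl⟩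
  -- `ker π₁ = K̄ := K.map mkQ`
  have hker₁ : LinearMap.ker π₁ = K.map R.mkQ := by
    refine le_antisymm ?_ ?_
    · intro y hy
      induction y using Submodule.Quotient.induction_on with
      | H b =>
        have hb : j b ∈ LinearMap.range g := by
          rw [LinearMap.mem_ker] at hy
          exact (Submodule.Quotient.mk_eq_zero _).mp hy
        obtain ⟨a, ha⟩ := LinearMap.mem_range.mp hb
        refine Submodule.mem_map.mpr ⟨b - s a, ?_, ?_⟩
        · rw [hK, LinearMap.mem_ker, map_sub, ← ha, hg, LinearMap.comp_apply, sub_self]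
        · rw [Submodule.mkQ_apply, Submodule.Quotient.mk_sub, sub_eq_self, Submodule.Quotient.mk_eq_zero]
          exact LinearMap.mem_range_self s a
    · rintro _ ⟨k, hk, rfl⟩
      rw [LinearMap.mem_ker]
      change Submodule.Quotient.mk (j k) = (0 : H ⧸ LinearMap.range g)
      have hk' : j k = 0 := hk
      rw [hk', Submodule.Quotient.mk_zero]
  -- `π₂ : K ↠ K̄` and its kernel `≅ ker g`
  let π₂ : K →ₗ[IwasawaAlgebra p] K.map R.mkQ := LinearMap.codRestrict (K.map R.mkQ) (R.mkQ ∘ₗ K.subtype) fun k ↦ Submodule.mem_map_of_mem k.2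
  have hπ₂ : Function.Surjective π₂ := by
    rintro ⟨y, hy⟩
    obtain ⟨k, hk, rfl⟩ := Submodule.mem_map.mp hy
    exact ⟨⟨k, hk⟩, rfl⟩
  have hsK : ∀ a : LinearMap.ker g, s (a : A) ∈ K := fun a ↦ by
    rw [hK, LinearMap.mem_ker, ← LinearMap.comp_apply, ← hg]
    exact a.2
  let m : LinearMap.ker g →ₗ[IwasawaAlgebra p] K := LinearMap.codRestrict K (s ∘ₗ (LinearMap.ker g).subtype) hsK
  have hm : ∀ a : LinearMap.ker g, m a ∈ LinearMap.ker π₂ := fun a ↦ by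
    rw [LinearMap.mem_ker]
    refine Subtype.ext ?_
    change R.mkQ (s (a : A)) = 0
    rw [Submodule.mkQ_apply, Submodule.Quotient.mk_eq_zero]
    exact LinearMap.mem_range_self s _
  let i : LinearMap.ker g →ₗ[IwasawaAlgebra p] LinearMap.ker π₂ := LinearMap.codRestrict _ m hm
  have hi : Function.Bijective i := by
    constructor
    · intro a a' h
      have h' : s (a : A) = s (a' : A) := congrArg (fun x : LinearMap.ker π₂ ↦ ((x : K) : B)) h
      exact Subtype.ext (hs h')
    · rintro ⟨⟨k, hkK⟩, hk⟩
      have hkR : k ∈ R := by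
        rw [LinearMap.mem_ker] at hk
        have h := congrArg Subtype.val hk
        change R.mkQ k = 0 at h
        rwa [Submodule.mkQ_apply, Submodule.Quotient.mk_eq_zero] at h
      obtain ⟨a, rfl⟩ := LinearMap.mem_range.mp hkR
      have ha : a ∈ LinearMap.ker g := by
        rw [LinearMap.mem_ker, hg, LinearMap.comp_apply]
        rw [hK, LinearMap.mem_ker] at hkK
        exact hkK
      exact ⟨⟨a, ha⟩, rfl⟩
  -- bookkeeping
  have h1 := Summit.BirchSwinnertonDyer.Rank1Residual.X2.DualRestrictionInvariants.lambdaInvariant_eq_add_of_surjective p π₁ ht₁ hπ₁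
  have h2 := Summit.BirchSwinnertonDyer.Rank1Residual.X2.DualRestrictionInvariants.lambdaInvariant_eq_add_of_surjective p π₂ ht₂ hπ₂
  have h3 : lambdaInvariant p (LinearMap.ker π₂) = lambdaInvariant p (LinearMap.ker g) :=
    (lambdaInvariant_eq_of_linearEquiv (LinearEquiv.ofBijective i hi)).symm
  have h4 : lambdaInvariant p (LinearMap.ker π₁) = lambdaInvariant p (K.map R.mkQ) :=
    lambdaInvariant_eq_of_linearEquiv (LinearEquiv.ofEq _ _ hker₁)
  rw [h1, h2, h3, h4]
  ring

end Summit.BirchSwinnertonDyer.BirchSwinnertonDyer.Theorems.SmallImageRttCharRoad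

end
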